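import Summits.BirchSwinnertonDyer.BirchSwinnertonDyer.Theorems.KatoDescentPotSupersingularKatoFiniteLevelStrictTamagawaReading
import Summits.BirchSwinnertonDyer.Rank1Residual.X11b.LocalKernelTamagawaExact
import Summits.BirchSwinnertonDyer.Rank1Residual.X2.GreenbergVatsalUnramifiedAway
import Summits.BirchSwinnertonDyer.Rank1Residual.X11b.MaxUnramifiedRestriction
import Summits.BirchSwinnertonDyer.Rank1Residual.X11b.LocalPrimaryFinite
import Summits.BirchSwinnertonDyer.Rank1Residual.X11b.UnramifiedPrimaryVanishing
import Literature.NumberTheory.EllipticCurves.CyclotomicZpExtension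
import Literature.NumberTheory.EllipticCurves.SubgroupSelmerCocycleCriteriaProofs
import HarnessLib

/-!
# Kato's (14.9.3) at finite level, part 27: the TAMAGAWA LOWER BOUND `p^{v_p(c_v)} ≤ #H¹_ur(K_v, E[p^∞])` at EVERY finite place
# `v ∤ p` — all reduction types, including split multiplicative with `p ∣ ord_v Δ` — from X11b's exact Greenberg Lemma 3.3
# (route `KatoDescentPotSupersingular` / `…Tame…`, crux M = stmt-BirchSwinnertonDyer-19196; route-free helper)

Seat `bsd-potss-rkm` g18 (prover; cell `bsd-potss`), item stmt-BirchSwinnertonDyer-19196 (`--supports … --as helper`; closes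
nothing).  HONEST FRAMING: BSD is not proved by any of this; nothing is booked; theorems only (no definition, no named fact).

The direction crux M consumes (memo `HOME/rkm/FINDING-19196-rkm-g18.md`, «DIRECTION NOTE»: the Tamagawa term sits on the SMALL side of M, so the
chain needs `#H¹_ur(ℚ_ℓ, E[p^∞]) ≥ c_ℓ^{(p)}`) is proved here at EVERY finite `v ∤ p`, closing the one case part 24 left open (split
multiplicative with `p ∣ ord_v Δ`).  Source: the X11b cell's EXACT Greenberg Lemma 3.3 (`AcSelmer.natCard_localKer_eq_pow_padicValNat_localTamagawaNumber`):
for a `ℤ_p`-extension `κ` of `K` in which `v` does not split completely, the local kernel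
`ker r_v = ker(H¹(D_v, E[p^∞]) → H¹(D_v ∩ Gal(K̄/K_∞), E[p^∞]))` has order `p^{v_p(c_v)}`.  For the CYCLOTOMIC `κ` no `v ∤ p` splits
completely (`X2.…not_decomp_le_kerSubgroup_of_isCyclotomic`) and `K_∞/K` is unramified at `v ∤ p` (`inertia_le_kerSubgroup_inf_decomp`), so
every class of `ker r_v` dies on the inertia group `I_{𝔓₀} = res I_{K_v}`; pulling back along the surjection `Γ_{K_v} ↠ D_v`
(`LocBridge.corestrict`, injective on `H¹`: `LocBridge.map_oneCocycleClass_eq_zero_iff`) embeds `ker r_v` into `H¹_ur(K_v, E[p^∞])`.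

* **`pow_padicValNat_localTamagawaNumber_le_natCard_unramifiedSubgroup_primary`** — `K` a number field with a cyclotomic `ℤ_p`-extension
  `κ` (for `K = ℚ`: `CyclotomicZp.zpExtension`), `E/K` elliptic, `v ∤ p` ANY finite place:
  **`p^{v_p(c_v)} ≤ #H¹_ur(K_v, E[p^∞])`**;
* `…_rat` — the same over `ℚ` with `κ` discharged (`CyclotomicZp.zpExtension p`).
Together with part 24 (EQUALITY at every `v ∤ p` not split multiplicative with `p ∣ ord_v Δ`), the local Tamagawa term of crux M's ledger is
kernel in the direction the node consumes at every place.

References: R. Greenberg, LNM 1716 (1999) §3 Lemma 3.3 (p. 87), §4 proof of Thm. 4.1 (pp. 74–75) [GreenbergLNM1716]; K. Kato, Astérisque 295 §14.8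
[Kato2004Asterisque]; J.-P. Serre, *Galois Cohomology* I §2.6 (b), I §5.1 [SerreGaloisCohomology1997]; L. Washington, GTM 83 Prop. 13.2,
§13.1 [Washington1997].
-/

-- the summit and its single problem are both named `BirchSwinnertonDyer` (registry layout D-0017)
set_option linter.dupNamespace false
set_option autoImplicit false

noncomputable section

open scoped Classical NumberField
open CategoryTheory Function Field NumberField IsDedekindDomain WeierstrassCurve
open Literature.NumberTheory.EllipticCurves Literature.NumberTheory.EllipticCurves.GreenbergSelmer
open Literature.NumberTheory.GaloisRepresentations
  Literature.NumberTheory.GaloisRepresentations.DiscreteGaloisModule Literature.NumberTheory.GaloisCohomology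
open Summit.BirchSwinnertonDyer.Rank1Residual.X11b.LocBridge
open Summit.BirchSwinnertonDyer.Rank1Residual.X11b.AcSelmer

namespace Summit.BirchSwinnertonDyer.BirchSwinnertonDyer.Theorems.KatoFiniteLevelCount

section LowerBound

variable {K : Type} [Field K] [NumberField K] (W : WeierstrassCurve K) [W.IsElliptic] (p : ℕ) [Fact p.Prime]
  (v : HeightOneSpectrum (𝓞 K))

/-- **The Tamagawa lower bound `p^{v_p(c_v)} ≤ #H¹_ur(K_v, E[p^∞])` at every finite place `v ∤ p`** (all reduction types), given a
cyclotomic `ℤ_p`-extension `κ` of `K`: X11b's exact local kernel `#ker r_v = p^{v_p(c_v)}` (Greenberg Lemma 3.3) embeds into the unramified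
classes of `H¹(K_v, E[p^∞])` by pull-back along `Γ_{K_v} ↠ D_v` (`K_∞/K` unramified at `v`, `I_{𝔓₀} = res I_{K_v}`).
[cite: GreenbergLNM1716, §3 Lemma 3.3 (p. 87) and §4 proof of Thm. 4.1 (pp. 74–75)] [cite: SerreGaloisCohomology1997, I §2.6 (b) and I §5.1]
[cite: Washington1997, Prop. 13.2] -/
theorem pow_padicValNat_localTamagawaNumber_le_natCard_unramifiedSubgroup_primary
    (κ : ZpExtension K p) (hκ : κ.IsCyclotomic) (hpv : (p : 𝓞 K) ∉ v.asIdeal) :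
    p ^ padicValNat p ((W.baseChange (v.adicCompletion K)).localTamagawaNumber (v.adicCompletionIntegers K)) ≤
      Nat.card (unramifiedSubgroup (GaloisRep.toLocal v (primaryGaloisModule W p)) 1) := by
  haveI : CompactSpace (absoluteGaloisGroup (v.adicCompletion K)) := absoluteGaloisGroup_compactSpace _
  -- Greenberg's Lemma 3.3, exact (X11b), in the cyclotomic tower
  have hv : ¬ decomp v ≤ κ.kerSubgroup :=
    Summit.BirchSwinnertonDyer.Rank1Residual.X2.GreenbergVatsalUnramifiedAway.not_decomp_le_kerSubgroup_of_isCyclotomic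
      κ v hκ hpv
  obtain ⟨hfinK, hcardK⟩ := natCard_localKer_eq_pow_padicValNat_localTamagawaNumber W κ hpv hv
  rw [← hcardK]
  -- the local cohomology group and its finiteness
  set ρ : DiscreteGaloisModule (v.adicCompletion K) (W.geomPrimaryTorsion p) :=
    GaloisRep.restrictField (v.adicCompletion K) (primaryGaloisModule W p) with hρ
  have hEP : localEulerPoincareCharacteristic (v.adicCompletion K) := by
    haveI : CharZero (v.adicCompletion K) := charZero_adicCompletion v
    exact localEulerPoincareCharacteristic_holds (v.adicCompletion K)
  haveI hfinH : Finite (galoisCohomology ρ 1) := finite_galoisCohomology_one_primary_restrictField W p v hEP hpv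
  change Nat.card (localKer κ.kerSubgroup (W.geomPrimaryTorsion p) v) ≤ Nat.card (unramifiedSubgroup ρ 1)
  -- the corestriction `Γ_{K_v} ↠ ⊤ ⊓ D_v` and the pull-back on `H¹`
  set D : Subgroup (absoluteGaloisGroup K) := (⊤ : Subgroup (absoluteGaloisGroup K)) ⊓ decomp v with hD
  have hDmem : ∀ g : absoluteGaloisGroup K, g ∈ D ↔ g ∈ Set.range (absGaloisRestrict K (v.adicCompletion K)) := by
    intro g
    rw [hD, Subgroup.mem_inf, mem_decomp_iff]
    exact ⟨fun ⟨_, σ, hσ⟩ => ⟨σ, hσ⟩, fun ⟨σ, hσ⟩ => ⟨Subgroup.mem_top g, σ, hσ⟩⟩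
  let θ := corestrict (absGaloisRestrict K (v.adicCompletion K)) D hDmem
  let f : TopRep.res (θ : absoluteGaloisGroup (v.adicCompletion K) →* D) (discreteTopRep D (W.geomPrimaryTorsion p)) ⟶
      ρ.toTopRep := TopRep.ofHom ⟨ContinuousLinearMap.id ℤ (W.geomPrimaryTorsion p), fun _ ↦ rfl⟩
  have hf : Function.Bijective f.hom := Function.bijective_id
  let Ψ : subgroupH1 D (W.geomPrimaryTorsion p) →+ galoisCohomology ρ 1 :=
    (ContinuousCohomology.map θ f 1).hom.toLinearMap.toAddMonoidHom
  have hΨ : ∀ φ : contOneCocycles (discreteTopRep D (W.geomPrimaryTorsion p)),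
      Ψ (oneCocycleClass _ φ) = ContinuousCohomology.map θ f 1 (oneCocycleClass _ φ) := fun _ => rfl
  -- `Ψ` is injective (pull-back along a surjection)
  have hΨinj : Function.Injective Ψ := by
    rw [injective_iff_map_eq_zero]
    intro c hc
    obtain ⟨φ, rfl⟩ := oneCocycleClass_surjective _ c
    have hc' : ContinuousCohomology.map θ f 1 (oneCocycleClass _ φ) = 0 := hc
    rw [map_oneCocycleClass_eq_zero_iff _ ρ.toTopRep θ f hf] at hc'
    obtain ⟨x, hx⟩ := hc'
    rw [oneCocycleClass_eq_zero_iff]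
    refine ⟨x, fun d => ?_⟩
    obtain ⟨l, rfl⟩ := corestrict_surjective (absGaloisRestrict K (v.adicCompletion K)) D hDmem d
    exact hx l
  -- `Ψ` maps `ker r_v` into the unramified classes
  have hΨur : ∀ c ∈ localKer κ.kerSubgroup (W.geomPrimaryTorsion p) v, Ψ c ∈ unramifiedSubgroup ρ 1 := by
    intro c hc
    obtain ⟨φ, rfl⟩ := oneCocycleClass_surjective _ c
    -- `c` dies on `ker κ ⊓ D_v ⊇ I_{𝔓₀}`: `φ` is principal there
    have hres : Literature.NumberTheory.EllipticCurves.resOfLe (W.geomPrimaryTorsion p)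
        (inf_le_inf_right (decomp v) (le_top : κ.kerSubgroup ≤ ⊤)) (oneCocycleClass _ φ) = 0 := hc
    obtain ⟨x, hx⟩ := (CocycleCriteria.resOfLe_oneCocycleClass_eq_zero_iff
      (inf_le_inf_right (decomp v) (le_top : κ.kerSubgroup ≤ ⊤)) φ).mp hres
    have hΨφ : Ψ (oneCocycleClass _ φ) = oneCocycleClass ρ.toTopRep (contOneCocycles.pullback θ f φ) :=
      map_oneCocycleClass (θ := θ) (f := f) (φ := φ)
    rw [hΨφ]
    refine (mem_unramifiedSubgroup_one_iff_exists ρ (contOneCocycles.pullback θ f φ)).mpr ⟨x, fun τ hτ => ?_⟩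
    have hτI : absGaloisRestrict K (v.adicCompletion K) τ ∈ κ.kerSubgroup ⊓ decomp v := by
      refine inertia_le_kerSubgroup_inf_decomp (κ := κ) hpv ?_
      rw [inertia_adicCompletionPrime_eq_map_absInertia]
      exact Subgroup.mem_map_of_mem _ hτ
    have hθτ : θ τ = Subgroup.inclusion (inf_le_inf_right (decomp v) (le_top : κ.kerSubgroup ≤ ⊤))
        ⟨absGaloisRestrict K (v.adicCompletion K) τ, hτI⟩ := Subtype.ext rfl
    rw [contOneCocycles.pullback_apply, hθτ, hx]
    rfl
  -- count
  haveI : Finite (unramifiedSubgroup ρ 1) := inferInstance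
  let g : localKer κ.kerSubgroup (W.geomPrimaryTorsion p) v → unramifiedSubgroup ρ 1 :=
    fun c => ⟨Ψ c.1, hΨur c.1 c.2⟩
  refine Nat.card_le_card_of_injective g fun a b hab => ?_
  exact Subtype.ext (hΨinj (congrArg Subtype.val hab))

/-- **Over `ℚ`: `p^{v_p(c_ℓ)} ≤ #H¹_ur(ℚ_ℓ, E[p^∞])` at every prime `ℓ ≠ p`** (the cyclotomic `ℤ_p`-extension of `ℚ` exists in the tree,
`CyclotomicZp.zpExtension`). [cite: GreenbergLNM1716, §3 Lemma 3.3 (p. 87) and §4 proof of Thm. 4.1 (pp. 74–75)] -/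
theorem pow_padicValNat_localTamagawaNumber_le_natCard_unramifiedSubgroup_primary_rat
    (W : WeierstrassCurve ℚ) [W.IsElliptic] (v : HeightOneSpectrum (𝓞 ℚ)) (hpv : (p : 𝓞 ℚ) ∉ v.asIdeal) :
    p ^ padicValNat p ((W.baseChange (v.adicCompletion ℚ)).localTamagawaNumber (v.adicCompletionIntegers ℚ)) ≤
      Nat.card (unramifiedSubgroup (GaloisRep.toLocal v (primaryGaloisModule W p)) 1) := by
  exact pow_padicValNat_localTamagawaNumber_le_natCard_unramifiedSubgroup_primary W p v
    (CyclotomicZp.zpExtension p) (CyclotomicZp.isCyclotomic_zpExtension p) hpv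

end LowerBound

end Summit.BirchSwinnertonDyer.BirchSwinnertonDyer.Theorems.KatoFiniteLevelCount

end
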